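import Summits.HodgeConjecture.HodgeConjecture.Theorems.Ring2WeilCoverageWeilGramLevel36SqrtNegThree
import Summits.HodgeConjecture.HodgeConjecture.Theorems.Ring2WeilCoverageRamifiedTypesLevel36
import HarnessLib

/-!
# Weil-type family coverage — THE COMPONENTS OF THE WEIL-TYPE `ℤ[ζ₃₆]`-SIXFOLDS, IV: the RAMIFIED type `𝔮₃`
# (`π_A = ζ³³(1 − ζ⁴)(1 − ζ²)`, `(𝔬𝔣₀)⁶ = (3)`, degree `3`) against `√−3`: Gram determinant `−5184 = −72²` — RIGHT sign,
# SPLIT: the type-`𝔮₃` polarised Weil-type `ℤ[ζ₃₆]`-sixfolds lie on row R0 for `ℚ(√−3)` (census W6.3.1)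

research route conditional on HC_CM; not a corollary; Q11.4-sentence-2 already refuted in dim ≥ 3.

Ring 2, WEIL-TYPE FAMILY-COVERAGE CENSUS (`HOME/WEIL-FAMILY-COVERAGE.md` `## b01`, block b01.41 (B)/(C): «`36` A: degree
`3 ≡ 1`: SPLIT (= b01.17 `A₃₆` `(1⁵,3)`)», S-pencil there), part 112 of the `Ring2WeilCoverage*` series; continues parts
109–111.  Part 49b (`Ring2WeilCoverageRamifiedTypesLevel36`) proved that EVERY `ℚ(√−3)`-balanced CM type `Φ` of
`ℚ(ζ₃₆)` carries a `Φ`-positive divisor of type `𝔣₀`, `𝔬𝔣₀ = (π_A)`.  Here: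

* §1 the eleven traces and **`det a(π_Aξ) = −5184 = −72²`** (`= N(π_A)·1728 = (−3)·1728`).
* §2 invariance (THEOREM L (i) at `36`); CENSUS FORM; class **`[−5184] = splitDiscriminantClass 3 3`**: **the type-`𝔮₃`
  (degree `3`) polarised Weil-type `ℤ[ζ₃₆]`-CM sixfolds — on EVERY `ℚ(√−3)`-balanced `Φ` — lie on the SPLIT
  component**, row R0 for `ℚ(√−3)` (census W6.3.1); b01.17's `A₃₆` with `(1,1,1,1,1,3)` is one.

HONEST FRAMING as parts 109–111; `HC_CM` is used nowhere.  No `def`, no named fact, no `sorry`.  Certificates from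
`work/py/gen6.py` + `lev36.py`, re-verified by `linear_combination`.

References: [cite: vanGeemen1994HodgeAV, Lemma 5.2 (2)–(4), 5.4 and (5.4.1)]; [cite: Shimura1998, §14.3 Prop. 4–5,
pp. 103–104]; census b01.17, b01.41 (B)/(C) (seat-derived).
-/

noncomputable section

open Polynomial NumberField Module
open scoped nonZeroDivisors

namespace Summit.HodgeConjecture.Ring2WeilCoverage.WeilGramLevel36TypeA

open Literature.AlgebraicGeometry.VanGeemen1994 (weilField weilNormResidueGroup)
open Literature.AlgebraicGeometry.Motives (CMType normUnitsSubgroup)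
open Literature.NumberTheory.ComplexMultiplication
open Summit.HodgeConjecture.Ring2WeilCoverage.TraceGramDeterminant (trace_aeval_zeta_mul_inv)
open Summit.HodgeConjecture.Ring2WeilCoverage.WeilGramCMPoint
open Summit.HodgeConjecture.Ring2WeilCoverage.RealUnitNormHalfSystems (complexConj_eq_inv)
open Summit.HodgeConjecture.Ring2WeilCoverage.CyclotomicPrincipalObstruction (complexConj_xi)
open Summit.HodgeConjecture.Ring2WeilCoverage.CyclotomicDifferent (isOfType_one_xi_top xi_ne_zero)
open Summit.HodgeConjecture.HodgeConjecture.Ring2.WeilCoverage (mk_neg_eq_split_of_odd mk_neg_ne_split_of_odd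
  mem_normUnitsSubgroup_of_sq_add_mul_sq)
open Summit.HodgeConjecture.HodgeConjecture.Ring2.Hypotheses (splitDiscriminantClass)
open Summit.HodgeConjecture.Ring2WeilCoverage.WeilGramLevel36
open Summit.HodgeConjecture.Ring2WeilCoverage.WeilGramLevel36Principal
open Summit.HodgeConjecture.Ring2WeilCoverage.WeilGramLevel36SqrtNegThree
open Summit.HodgeConjecture.Ring2WeilCoverage.CyclotomicUnconditional (norm_realUnits_pos_thirtySix)
open Summit.HodgeConjecture.Ring2WeilCoverage.RamifiedTypes (isOfType_one_gen_mul_xi complexConj_gen_mul_xi gen_ne_zero)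
open Summit.HodgeConjecture.Ring2WeilCoverage.RamifiedTypesLevel36 (adm_thirtySixA exists_type_thirtySixA_sqrt_neg_three)
variable {K : Type} [Field K] [NumberField K] {ζ : K}

/-- `𝐞(t) = exp(2πi t/n) ∈ ℂ` (`ZMod.toCircle`). -/
local notation3 (prettyPrint := false) "𝐞 " t:max => ((ZMod.toCircle t : Circle) : ℂ)

/-- the residue set `S_Φ` read at level `36`. -/
local notation3 (prettyPrint := false) "SΦ[" Φ "," z "]" =>
  (Finset.univ.filter fun t : ZMod 36 => ∃ σ ∈ (Φ : CMType K).1, σ (z : K) = 𝐞 t)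

/-! ### §1 Type `𝔮₃`: `ζ′ = π_Aξ` — eleven traces, `det a = −5184` -/

/-- `Tr(ζ′sθ^0) = 0` for `ζ′ = π_Aξ, π_A = ζ³³(1 − ζ⁴)(1 − ζ²)`, `s = √−3 = 1 + 2ζ¹²`, `θ = ζ + ζ⁻¹` (Euler evaluation). research route conditional on HC_CM; not a corollary; Q11.4-sentence-2 already refuted in dim ≥ 3. [folklore] -/
theorem trace_piA_sqrtNegThree_zero [IsCyclotomicExtension {36} ℚ K] (hζ : IsPrimitiveRoot ζ 36) :
    Algebra.trace ℚ K ((ζ ^ 33 * (1 - ζ ^ 4) * (1 - ζ ^ 2) * (ζ ^ 5 * (aeval ζ (derivative (cyclotomic 36 ℚ)))⁻¹)) * (1 + 2 * ζ ^ 12)) = 0 := by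
  have h36 : ζ ^ 36 = 1 := hζ.pow_eq_one
  have hΦ := cyc_thirtySix hζ
  rw [trace_of_key₀ hζ (C (2 : ℚ) + C (0 : ℚ) * X + C (-3 : ℚ) * X ^ 2 + C (0 : ℚ) * X ^ 3 + C (1 : ℚ) * X ^ 4 + C (0 : ℚ) * X ^ 5 +
      C (-1 : ℚ) * X ^ 6 + C (0 : ℚ) * X ^ 7 + C (3 : ℚ) * X ^ 8 + C (0 : ℚ) * X ^ 9 + C (-2 : ℚ) * X ^ 10 +
      C (0 : ℚ) * X ^ 11) (by compute_degree) (by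
    simp only [map_add, map_mul, map_pow, aeval_C, aeval_X, eq_ratCast]
    push_cast
    linear_combination ((aeval ζ (derivative (cyclotomic 36 ℚ)))⁻¹ * (-2 + 4 * ζ^2 - 2 * ζ^4 - 2 * ζ^6 + 2 * ζ^8)) * hΦ +
      ((aeval ζ (derivative (cyclotomic 36 ℚ)))⁻¹ * (ζ^2 - ζ^4 - ζ^6 + ζ^8 + 2 * ζ^14 - 2 * ζ^16 - 2 * ζ^18 + 2 * ζ^20)) * h36)]
  norm_num [coeff_X_pow, coeff_X, coeff_C, coeff_one]

/-- `Tr(ζ′sθ^1) = -4` for `ζ′ = π_Aξ, π_A = ζ³³(1 − ζ⁴)(1 − ζ²)`, `s = √−3 = 1 + 2ζ¹²`, `θ = ζ + ζ⁻¹` (Euler evaluation). research route conditional on HC_CM; not a corollary; Q11.4-sentence-2 already refuted in dim ≥ 3. [folklore] -/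
theorem trace_piA_sqrtNegThree_one [IsCyclotomicExtension {36} ℚ K] (hζ : IsPrimitiveRoot ζ 36) :
    Algebra.trace ℚ K ((ζ ^ 33 * (1 - ζ ^ 4) * (1 - ζ ^ 2) * (ζ ^ 5 * (aeval ζ (derivative (cyclotomic 36 ℚ)))⁻¹)) * (1 + 2 * ζ ^ 12) * (ζ + ζ⁻¹)) = -4 := by
  have h36 : ζ ^ 36 = 1 := hζ.pow_eq_one
  have hΦ := cyc_thirtySix hζ
  rw [trace_of_key₁ hζ (C (0 : ℚ) + C (-1 : ℚ) * X + C (0 : ℚ) * X ^ 2 + C (-2 : ℚ) * X ^ 3 + C (0 : ℚ) * X ^ 4 +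
      C (2 : ℚ) * X ^ 5 + C (0 : ℚ) * X ^ 6 + C (2 : ℚ) * X ^ 7 + C (0 : ℚ) * X ^ 8 + C (1 : ℚ) * X ^ 9 +
      C (0 : ℚ) * X ^ 10 + C (-4 : ℚ) * X ^ 11) (by compute_degree) (by
    simp only [map_add, map_mul, map_pow, aeval_C, aeval_X, eq_ratCast]
    push_cast
    linear_combination ((aeval ζ (derivative (cyclotomic 36 ℚ)))⁻¹ * (2 * ζ^2 + 2 * ζ^4 - 4 * ζ^6 + 2 * ζ^10)) * hΦ +
      ((aeval ζ (derivative (cyclotomic 36 ℚ)))⁻¹ * (ζ^2 - 2 * ζ^6 + ζ^10 + 2 * ζ^14 - 4 * ζ^18 + 2 * ζ^22)) * h36)]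
  norm_num [coeff_X_pow, coeff_X, coeff_C, coeff_one]

/-- `Tr(ζ′sθ^2) = 0` for `ζ′ = π_Aξ, π_A = ζ³³(1 − ζ⁴)(1 − ζ²)`, `s = √−3 = 1 + 2ζ¹²`, `θ = ζ + ζ⁻¹` (Euler evaluation). research route conditional on HC_CM; not a corollary; Q11.4-sentence-2 already refuted in dim ≥ 3. [folklore] -/
theorem trace_piA_sqrtNegThree_two [IsCyclotomicExtension {36} ℚ K] (hζ : IsPrimitiveRoot ζ 36) :
    Algebra.trace ℚ K ((ζ ^ 33 * (1 - ζ ^ 4) * (1 - ζ ^ 2) * (ζ ^ 5 * (aeval ζ (derivative (cyclotomic 36 ℚ)))⁻¹)) * (1 + 2 * ζ ^ 12) * (ζ + ζ⁻¹) ^ 2) = 0 := by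
  have h36 : ζ ^ 36 = 1 := hζ.pow_eq_one
  have hΦ := cyc_thirtySix hζ
  rw [trace_of_key hζ (C (3 : ℚ) + C (0 : ℚ) * X + C (-3 : ℚ) * X ^ 2 + C (0 : ℚ) * X ^ 3 + C (0 : ℚ) * X ^ 4 + C (0 : ℚ) * X ^ 5 +
      C (0 : ℚ) * X ^ 6 + C (0 : ℚ) * X ^ 7 + C (3 : ℚ) * X ^ 8 + C (0 : ℚ) * X ^ 9 + C (-3 : ℚ) * X ^ 10 +
      C (0 : ℚ) * X ^ 11) (by compute_degree) (by
    simp only [map_add, map_mul, map_pow, aeval_C, aeval_X, eq_ratCast]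
    push_cast
    linear_combination ((aeval ζ (derivative (cyclotomic 36 ℚ)))⁻¹ * (-2 * ζ^2 + 4 * ζ^4 - 2 * ζ^6 - 4 * ζ^8 + 2 * ζ^10 + 2 * ζ^12)) * hΦ +
      ((aeval ζ (derivative (cyclotomic 36 ℚ)))⁻¹ * (ζ^2 + ζ^4 - 2 * ζ^6 - 2 * ζ^8 + ζ^10 + ζ^12 + 2 * ζ^14 + 2 * ζ^16 -
        4 * ζ^18 - 4 * ζ^20 + 2 * ζ^22 + 2 * ζ^24)) * h36)]
  norm_num [coeff_X_pow, coeff_X, coeff_C, coeff_one]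

/-- `Tr(ζ′sθ^3) = -6` for `ζ′ = π_Aξ, π_A = ζ³³(1 − ζ⁴)(1 − ζ²)`, `s = √−3 = 1 + 2ζ¹²`, `θ = ζ + ζ⁻¹` (Euler evaluation). research route conditional on HC_CM; not a corollary; Q11.4-sentence-2 already refuted in dim ≥ 3. [folklore] -/
theorem trace_piA_sqrtNegThree_three [IsCyclotomicExtension {36} ℚ K] (hζ : IsPrimitiveRoot ζ 36) :
    Algebra.trace ℚ K ((ζ ^ 33 * (1 - ζ ^ 4) * (1 - ζ ^ 2) * (ζ ^ 5 * (aeval ζ (derivative (cyclotomic 36 ℚ)))⁻¹)) * (1 + 2 * ζ ^ 12) * (ζ + ζ⁻¹) ^ 3) = -6 := by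
  have h36 : ζ ^ 36 = 1 := hζ.pow_eq_one
  have hΦ := cyc_thirtySix hζ
  rw [trace_of_key hζ (C (0 : ℚ) + C (0 : ℚ) * X + C (0 : ℚ) * X ^ 2 + C (-3 : ℚ) * X ^ 3 + C (0 : ℚ) * X ^ 4 + C (3 : ℚ) * X ^ 5 +
      C (0 : ℚ) * X ^ 6 + C (3 : ℚ) * X ^ 7 + C (0 : ℚ) * X ^ 8 + C (0 : ℚ) * X ^ 9 + C (0 : ℚ) * X ^ 10 +
      C (-6 : ℚ) * X ^ 11) (by compute_degree) (by
    simp only [map_add, map_mul, map_pow, aeval_C, aeval_X, eq_ratCast]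
    push_cast
    linear_combination ((aeval ζ (derivative (cyclotomic 36 ℚ)))⁻¹ * (ζ^2 + 2 * ζ^4 + 2 * ζ^6 - 6 * ζ^8 - 2 * ζ^10 + 4 * ζ^12 + 2 * ζ^14)) * hΦ +
      ((aeval ζ (derivative (cyclotomic 36 ℚ)))⁻¹ * (ζ^2 + 2 * ζ^4 - ζ^6 - 4 * ζ^8 - ζ^10 + 2 * ζ^12 + 3 * ζ^14 + 4 * ζ^16 -
        2 * ζ^18 - 8 * ζ^20 - 2 * ζ^22 + 4 * ζ^24 + 2 * ζ^26)) * h36)]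
  norm_num [coeff_X_pow, coeff_X, coeff_C, coeff_one]

/-- `Tr(ζ′sθ^4) = 0` for `ζ′ = π_Aξ, π_A = ζ³³(1 − ζ⁴)(1 − ζ²)`, `s = √−3 = 1 + 2ζ¹²`, `θ = ζ + ζ⁻¹` (Euler evaluation). research route conditional on HC_CM; not a corollary; Q11.4-sentence-2 already refuted in dim ≥ 3. [folklore] -/
theorem trace_piA_sqrtNegThree_four [IsCyclotomicExtension {36} ℚ K] (hζ : IsPrimitiveRoot ζ 36) :
    Algebra.trace ℚ K ((ζ ^ 33 * (1 - ζ ^ 4) * (1 - ζ ^ 2) * (ζ ^ 5 * (aeval ζ (derivative (cyclotomic 36 ℚ)))⁻¹)) * (1 + 2 * ζ ^ 12) * (ζ + ζ⁻¹) ^ 4) = 0 := by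
  have h36 : ζ ^ 36 = 1 := hζ.pow_eq_one
  have hΦ := cyc_thirtySix hζ
  rw [trace_of_key hζ (C (6 : ℚ) + C (0 : ℚ) * X + C (-3 : ℚ) * X ^ 2 + C (0 : ℚ) * X ^ 3 + C (0 : ℚ) * X ^ 4 + C (0 : ℚ) * X ^ 5 +
      C (0 : ℚ) * X ^ 6 + C (0 : ℚ) * X ^ 7 + C (3 : ℚ) * X ^ 8 + C (0 : ℚ) * X ^ 9 + C (-6 : ℚ) * X ^ 10 +
      C (0 : ℚ) * X ^ 11) (by compute_degree) (by
    simp only [map_add, map_mul, map_pow, aeval_C, aeval_X, eq_ratCast]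
    push_cast
    linear_combination ((aeval ζ (derivative (cyclotomic 36 ℚ)))⁻¹ * (ζ^2 - 3 * ζ^4 + 4 * ζ^6 - 4 * ζ^8 - 8 * ζ^10 + 2 * ζ^12 + 6 * ζ^14 +
        2 * ζ^16)) * hΦ +
      ((aeval ζ (derivative (cyclotomic 36 ℚ)))⁻¹ * (ζ^2 + 3 * ζ^4 + ζ^6 - 5 * ζ^8 - 5 * ζ^10 + ζ^12 + 5 * ζ^14 + 7 * ζ^16 +
        2 * ζ^18 - 10 * ζ^20 - 10 * ζ^22 + 2 * ζ^24 + 6 * ζ^26 + 2 * ζ^28)) * h36)]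
  norm_num [coeff_X_pow, coeff_X, coeff_C, coeff_one]

/-- `Tr(ζ′sθ^5) = -12` for `ζ′ = π_Aξ, π_A = ζ³³(1 − ζ⁴)(1 − ζ²)`, `s = √−3 = 1 + 2ζ¹²`, `θ = ζ + ζ⁻¹` (Euler evaluation). research route conditional on HC_CM; not a corollary; Q11.4-sentence-2 already refuted in dim ≥ 3. [folklore] -/
theorem trace_piA_sqrtNegThree_five [IsCyclotomicExtension {36} ℚ K] (hζ : IsPrimitiveRoot ζ 36) :
    Algebra.trace ℚ K ((ζ ^ 33 * (1 - ζ ^ 4) * (1 - ζ ^ 2) * (ζ ^ 5 * (aeval ζ (derivative (cyclotomic 36 ℚ)))⁻¹)) * (1 + 2 * ζ ^ 12) * (ζ + ζ⁻¹) ^ 5) = -12 := by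
  have h36 : ζ ^ 36 = 1 := hζ.pow_eq_one
  have hΦ := cyc_thirtySix hζ
  rw [trace_of_key hζ (C (0 : ℚ) + C (3 : ℚ) * X + C (0 : ℚ) * X ^ 2 + C (-3 : ℚ) * X ^ 3 + C (0 : ℚ) * X ^ 4 + C (6 : ℚ) * X ^ 5 +
      C (0 : ℚ) * X ^ 6 + C (3 : ℚ) * X ^ 7 + C (0 : ℚ) * X ^ 8 + C (-3 : ℚ) * X ^ 9 + C (0 : ℚ) * X ^ 10 +
      C (-12 : ℚ) * X ^ 11) (by compute_degree) (by
    simp only [map_add, map_mul, map_pow, aeval_C, aeval_X, eq_ratCast]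
    push_cast
    linear_combination ((aeval ζ (derivative (cyclotomic 36 ℚ)))⁻¹ * (ζ^2 + 4 * ζ^4 + ζ^6 - 12 * ζ^10 - 6 * ζ^12 + 8 * ζ^14 + 8 * ζ^16 +
        2 * ζ^18)) * hΦ +
      ((aeval ζ (derivative (cyclotomic 36 ℚ)))⁻¹ * (ζ^2 + 4 * ζ^4 + 4 * ζ^6 - 4 * ζ^8 - 10 * ζ^10 - 4 * ζ^12 + 6 * ζ^14 +
        12 * ζ^16 + 9 * ζ^18 - 8 * ζ^20 - 20 * ζ^22 - 8 * ζ^24 + 8 * ζ^26 +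
        8 * ζ^28 + 2 * ζ^30)) * h36)]
  norm_num [coeff_X_pow, coeff_X, coeff_C, coeff_one]

/-- `Tr(ζ′sθ^6) = 0` for `ζ′ = π_Aξ, π_A = ζ³³(1 − ζ⁴)(1 − ζ²)`, `s = √−3 = 1 + 2ζ¹²`, `θ = ζ + ζ⁻¹` (Euler evaluation). research route conditional on HC_CM; not a corollary; Q11.4-sentence-2 already refuted in dim ≥ 3. [folklore] -/
theorem trace_piA_sqrtNegThree_six [IsCyclotomicExtension {36} ℚ K] (hζ : IsPrimitiveRoot ζ 36) :
    Algebra.trace ℚ K ((ζ ^ 33 * (1 - ζ ^ 4) * (1 - ζ ^ 2) * (ζ ^ 5 * (aeval ζ (derivative (cyclotomic 36 ℚ)))⁻¹)) * (1 + 2 * ζ ^ 12) * (ζ + ζ⁻¹) ^ 6) = 0 := by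
  have h36 : ζ ^ 36 = 1 := hζ.pow_eq_one
  have hΦ := cyc_thirtySix hζ
  rw [trace_of_key hζ (C (15 : ℚ) + C (0 : ℚ) * X + C (0 : ℚ) * X ^ 2 + C (0 : ℚ) * X ^ 3 + C (3 : ℚ) * X ^ 4 + C (0 : ℚ) * X ^ 5 +
      C (-3 : ℚ) * X ^ 6 + C (0 : ℚ) * X ^ 7 + C (0 : ℚ) * X ^ 8 + C (0 : ℚ) * X ^ 9 + C (-15 : ℚ) * X ^ 10 +
      C (0 : ℚ) * X ^ 11) (by compute_degree) (by
    simp only [map_add, map_mul, map_pow, aeval_C, aeval_X, eq_ratCast]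
    push_cast
    linear_combination ((aeval ζ (derivative (cyclotomic 36 ℚ)))⁻¹ * (ζ^2 + 5 * ζ^4 - 7 * ζ^6 + ζ^8 - 12 * ζ^10 - 18 * ζ^12 + 2 * ζ^14 +
        16 * ζ^16 + 10 * ζ^18 + 2 * ζ^20)) * hΦ +
      ((aeval ζ (derivative (cyclotomic 36 ℚ)))⁻¹ * (ζ^2 + 5 * ζ^4 + 8 * ζ^6 - 14 * ζ^10 - 14 * ζ^12 + 2 * ζ^14 + 18 * ζ^16 +
        21 * ζ^18 + ζ^20 - 28 * ζ^22 - 28 * ζ^24 + 16 * ζ^28 + 10 * ζ^30 +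
        2 * ζ^32)) * h36)]
  norm_num [coeff_X_pow, coeff_X, coeff_C, coeff_one]

/-- `Tr(ζ′sθ^7) = -30` for `ζ′ = π_Aξ, π_A = ζ³³(1 − ζ⁴)(1 − ζ²)`, `s = √−3 = 1 + 2ζ¹²`, `θ = ζ + ζ⁻¹` (Euler evaluation). research route conditional on HC_CM; not a corollary; Q11.4-sentence-2 already refuted in dim ≥ 3. [folklore] -/
theorem trace_piA_sqrtNegThree_seven [IsCyclotomicExtension {36} ℚ K] (hζ : IsPrimitiveRoot ζ 36) :
    Algebra.trace ℚ K ((ζ ^ 33 * (1 - ζ ^ 4) * (1 - ζ ^ 2) * (ζ ^ 5 * (aeval ζ (derivative (cyclotomic 36 ℚ)))⁻¹)) * (1 + 2 * ζ ^ 12) * (ζ + ζ⁻¹) ^ 7) = -30 := by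
  have h36 : ζ ^ 36 = 1 := hζ.pow_eq_one
  have hΦ := cyc_thirtySix hζ
  rw [trace_of_key hζ (C (0 : ℚ) + C (15 : ℚ) * X + C (0 : ℚ) * X ^ 2 + C (3 : ℚ) * X ^ 3 + C (0 : ℚ) * X ^ 4 +
      C (15 : ℚ) * X ^ 5 + C (0 : ℚ) * X ^ 6 + C (-3 : ℚ) * X ^ 7 + C (0 : ℚ) * X ^ 8 + C (-15 : ℚ) * X ^ 9 +
      C (0 : ℚ) * X ^ 10 + C (-30 : ℚ) * X ^ 11) (by compute_degree) (by
    simp only [map_add, map_mul, map_pow, aeval_C, aeval_X, eq_ratCast]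
    push_cast
    linear_combination ((aeval ζ (derivative (cyclotomic 36 ℚ)))⁻¹ * (ζ^2 + 6 * ζ^4 + 13 * ζ^6 - 6 * ζ^8 - 11 * ζ^10 - 30 * ζ^12 - 16 * ζ^14 +
        18 * ζ^16 + 26 * ζ^18 + 12 * ζ^20 + 2 * ζ^22)) * hΦ +
      ((aeval ζ (derivative (cyclotomic 36 ℚ)))⁻¹ * (ζ^2 + 6 * ζ^4 + 13 * ζ^6 + 8 * ζ^8 - 14 * ζ^10 - 28 * ζ^12 - 12 * ζ^14 +
        20 * ζ^16 + 39 * ζ^18 + 22 * ζ^20 - 27 * ζ^22 - 56 * ζ^24 - 28 * ζ^26 +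
        16 * ζ^28 + 26 * ζ^30 + 12 * ζ^32 + 2 * ζ^34)) * h36)]
  norm_num [coeff_X_pow, coeff_X, coeff_C, coeff_one]

/-- `Tr(ζ′sθ^8) = 0` for `ζ′ = π_Aξ, π_A = ζ³³(1 − ζ⁴)(1 − ζ²)`, `s = √−3 = 1 + 2ζ¹²`, `θ = ζ + ζ⁻¹` (Euler evaluation). research route conditional on HC_CM; not a corollary; Q11.4-sentence-2 already refuted in dim ≥ 3. [folklore] -/
theorem trace_piA_sqrtNegThree_eight [IsCyclotomicExtension {36} ℚ K] (hζ : IsPrimitiveRoot ζ 36) :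
    Algebra.trace ℚ K ((ζ ^ 33 * (1 - ζ ^ 4) * (1 - ζ ^ 2) * (ζ ^ 5 * (aeval ζ (derivative (cyclotomic 36 ℚ)))⁻¹)) * (1 + 2 * ζ ^ 12) * (ζ + ζ⁻¹) ^ 8) = 0 := by
  have h36 : ζ ^ 36 = 1 := hζ.pow_eq_one
  have hΦ := cyc_thirtySix hζ
  rw [trace_of_key hζ (C (45 : ℚ) + C (0 : ℚ) * X + C (18 : ℚ) * X ^ 2 + C (0 : ℚ) * X ^ 3 + C (18 : ℚ) * X ^ 4 +
      C (0 : ℚ) * X ^ 5 + C (-18 : ℚ) * X ^ 6 + C (0 : ℚ) * X ^ 7 + C (-18 : ℚ) * X ^ 8 + C (0 : ℚ) * X ^ 9 +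
      C (-45 : ℚ) * X ^ 10 + C (0 : ℚ) * X ^ 11) (by compute_degree) (by
    simp only [map_add, map_mul, map_pow, aeval_C, aeval_X, eq_ratCast]
    push_cast
    linear_combination ((aeval ζ (derivative (cyclotomic 36 ℚ)))⁻¹ * (2 + ζ^2 + 7 * ζ^4 + 21 * ζ^6 - 23 * ζ^8 - 17 * ζ^10 - 41 * ζ^12 -
        46 * ζ^14 + 2 * ζ^16 + 42 * ζ^18 + 38 * ζ^20 + 14 * ζ^22)) * hΦ +
      ((aeval ζ (derivative (cyclotomic 36 ℚ)))⁻¹ * (2 + ζ^2 + 7 * ζ^4 + 19 * ζ^6 + 21 * ζ^8 - 6 * ζ^10 - 42 * ζ^12 -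
        40 * ζ^14 + 8 * ζ^16 + 59 * ζ^18 + 61 * ζ^20 - 5 * ζ^22 - 83 * ζ^24 -
        84 * ζ^26 - 12 * ζ^28 + 42 * ζ^30 + 38 * ζ^32 + 14 * ζ^34 + 2 * ζ^36)) * h36)]
  norm_num [coeff_X_pow, coeff_X, coeff_C, coeff_one]

/-- `Tr(ζ′sθ^9) = -90` for `ζ′ = π_Aξ, π_A = ζ³³(1 − ζ⁴)(1 − ζ²)`, `s = √−3 = 1 + 2ζ¹²`, `θ = ζ + ζ⁻¹` (Euler evaluation). research route conditional on HC_CM; not a corollary; Q11.4-sentence-2 already refuted in dim ≥ 3. [folklore] -/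
theorem trace_piA_sqrtNegThree_nine [IsCyclotomicExtension {36} ℚ K] (hζ : IsPrimitiveRoot ζ 36) :
    Algebra.trace ℚ K ((ζ ^ 33 * (1 - ζ ^ 4) * (1 - ζ ^ 2) * (ζ ^ 5 * (aeval ζ (derivative (cyclotomic 36 ℚ)))⁻¹)) * (1 + 2 * ζ ^ 12) * (ζ + ζ⁻¹) ^ 9) = -90 := by
  have h36 : ζ ^ 36 = 1 := hζ.pow_eq_one
  have hΦ := cyc_thirtySix hζ
  rw [trace_of_key hζ (C (0 : ℚ) + C (63 : ℚ) * X + C (0 : ℚ) * X ^ 2 + C (36 : ℚ) * X ^ 3 + C (0 : ℚ) * X ^ 4 +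
      C (45 : ℚ) * X ^ 5 + C (0 : ℚ) * X ^ 6 + C (-36 : ℚ) * X ^ 7 + C (0 : ℚ) * X ^ 8 + C (-63 : ℚ) * X ^ 9 +
      C (0 : ℚ) * X ^ 10 + C (-90 : ℚ) * X ^ 11) (by compute_degree) (by
    simp only [map_add, map_mul, map_pow, aeval_C, aeval_X, eq_ratCast]
    push_cast
    linear_combination ((aeval ζ (derivative (cyclotomic 36 ℚ)))⁻¹ * (16 + 3 * ζ^2 + 8 * ζ^4 + 42 * ζ^6 + 43 * ζ^8 - 40 * ζ^10 - 58 * ζ^12 -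
        87 * ζ^14 - 44 * ζ^16 + 30 * ζ^18 + 80 * ζ^20 + 52 * ζ^22)) * hΦ +
      ((aeval ζ (derivative (cyclotomic 36 ℚ)))⁻¹ * (16 + 3 * ζ^2 + 8 * ζ^4 + 26 * ζ^6 + 40 * ζ^8 + 15 * ζ^10 - 48 * ζ^12 -
        82 * ζ^14 - 32 * ζ^16 + 67 * ζ^18 + 120 * ζ^20 + 56 * ζ^22 - 88 * ζ^24 -
        167 * ζ^26 - 96 * ζ^28 + 30 * ζ^30 + 80 * ζ^32 + 52 * ζ^34 + 16 * ζ^36 +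
        2 * ζ^38)) * h36)]
  norm_num [coeff_X_pow, coeff_X, coeff_C, coeff_one]

/-- `Tr(ζ′sθ^10) = 0` for `ζ′ = π_Aξ, π_A = ζ³³(1 − ζ⁴)(1 − ζ²)`, `s = √−3 = 1 + 2ζ¹²`, `θ = ζ + ζ⁻¹` (Euler evaluation). research route conditional on HC_CM; not a corollary; Q11.4-sentence-2 already refuted in dim ≥ 3. [folklore] -/
theorem trace_piA_sqrtNegThree_ten [IsCyclotomicExtension {36} ℚ K] (hζ : IsPrimitiveRoot ζ 36) :
    Algebra.trace ℚ K ((ζ ^ 33 * (1 - ζ ^ 4) * (1 - ζ ^ 2) * (ζ ^ 5 * (aeval ζ (derivative (cyclotomic 36 ℚ)))⁻¹)) * (1 + 2 * ζ ^ 12) * (ζ + ζ⁻¹) ^ 10) = 0 := by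
  have h36 : ζ ^ 36 = 1 := hζ.pow_eq_one
  have hΦ := cyc_thirtySix hζ
  rw [trace_of_key hζ (C (153 : ℚ) + C (0 : ℚ) * X + C (99 : ℚ) * X ^ 2 + C (0 : ℚ) * X ^ 3 + C (81 : ℚ) * X ^ 4 +
      C (0 : ℚ) * X ^ 5 + C (-81 : ℚ) * X ^ 6 + C (0 : ℚ) * X ^ 7 + C (-99 : ℚ) * X ^ 8 + C (0 : ℚ) * X ^ 9 +
      C (-153 : ℚ) * X ^ 10 + C (0 : ℚ) * X ^ 11) (by compute_degree) (by
    simp only [map_add, map_mul, map_pow, aeval_C, aeval_X, eq_ratCast]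
    push_cast
    linear_combination ((aeval ζ (derivative (cyclotomic 36 ℚ)))⁻¹ * (68 + 19 * ζ^2 + 11 * ζ^4 + 102 * ζ^6 + 85 * ζ^8 - 87 * ζ^10 - 98 * ζ^12 -
        145 * ζ^14 - 131 * ζ^16 - 66 * ζ^18 + 110 * ζ^20 + 132 * ζ^22)) * hΦ +
      ((aeval ζ (derivative (cyclotomic 36 ℚ)))⁻¹ * (68 + 19 * ζ^2 + 11 * ζ^4 + 34 * ζ^6 + 66 * ζ^8 + 55 * ζ^10 - 33 * ζ^12 -
        130 * ζ^14 - 114 * ζ^16 + 35 * ζ^18 + 187 * ζ^20 + 176 * ζ^22 -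
        32 * ζ^24 - 255 * ζ^26 - 263 * ζ^28 - 66 * ζ^30 + 110 * ζ^32 +
        132 * ζ^34 + 68 * ζ^36 + 18 * ζ^38 + 2 * ζ^40)) * h36)]
  norm_num [coeff_X_pow, coeff_X, coeff_C, coeff_one]

/-- **The Gram datum `a` of `(E_ζ′, s)` in the real frame `θ^i` (`i < 6`)** for `ζ′ = π_Aξ, π_A = ζ³³(1 − ζ⁴)(1 − ζ²)` (type 𝔮₃: `𝔬𝔣₀ = (π_A)`, `(𝔬𝔣₀)⁶ = (3)`, degree 3),
`s = √−3 = 1 + 2ζ¹²`: the integer Hankel matrix `(−Tr(ζ′sθ^{i+j}))ᵢⱼ` (and `b = 0`, part 82 `hb_eq_zero`).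
research route conditional on HC_CM; not a corollary; Q11.4-sentence-2 already refuted in dim ≥ 3. [cite: vanGeemen1994HodgeAV, Lemma 5.2 (2)–(3)] -/
theorem realPart_piA_sqrtNegThree [IsCyclotomicExtension {36} ℚ K] [IsCMField K] (hζ : IsPrimitiveRoot ζ 36)
    {x : Fin 6 → K} (hx : ∀ i, x i = (ζ + ζ⁻¹) ^ (i : ℕ)) {a : Matrix (Fin 6) (Fin 6) ℚ}
    (ha : ∀ i j, a i j = Algebra.trace ℚ K ((ζ ^ 33 * (1 - ζ ^ 4) * (1 - ζ ^ 2) * (ζ ^ 5 * (aeval ζ (derivative (cyclotomic 36 ℚ)))⁻¹)) * x i * IsCMField.complexConj K ((1 + 2 * ζ ^ 12) * x j))) :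
    a = !![0, 4, 0, 6, 0, 12; 4, 0, 6, 0, 12, 0; 0, 6, 0, 12, 0, 30; 6, 0, 12, 0, 30, 0; 0, 12, 0, 30, 0, 90; 12, 0, 30, 0, 90, 0] := by
  rw [ha_eq (complexConj_sqrtNegThree hζ) (complexConj_thetaFrame hζ hx) ha]
  ext i j
  simp only [Matrix.of_apply, hx, ← pow_add]
  fin_cases i <;> fin_cases j <;> simp [trace_piA_sqrtNegThree_zero hζ, trace_piA_sqrtNegThree_one hζ, trace_piA_sqrtNegThree_two hζ, trace_piA_sqrtNegThree_three hζ, trace_piA_sqrtNegThree_four hζ, trace_piA_sqrtNegThree_five hζ,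
    trace_piA_sqrtNegThree_six hζ, trace_piA_sqrtNegThree_seven hζ, trace_piA_sqrtNegThree_eight hζ, trace_piA_sqrtNegThree_nine hζ, trace_piA_sqrtNegThree_ten hζ]

/-- **`det a = -5184`** for `ζ′ = π_Aξ, π_A = ζ³³(1 − ζ⁴)(1 − ζ²)`, `s = √−3 = 1 + 2ζ¹²` (frame `θ^i`, `i < 6`). research route conditional on HC_CM; not a corollary; Q11.4-sentence-2 already refuted in dim ≥ 3. [cite: vanGeemen1994HodgeAV, Lemma 5.2 (3)] -/
theorem det_realPart_piA_sqrtNegThree [IsCyclotomicExtension {36} ℚ K] [IsCMField K] (hζ : IsPrimitiveRoot ζ 36)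
    {x : Fin 6 → K} (hx : ∀ i, x i = (ζ + ζ⁻¹) ^ (i : ℕ)) {a : Matrix (Fin 6) (Fin 6) ℚ}
    (ha : ∀ i j, a i j = Algebra.trace ℚ K ((ζ ^ 33 * (1 - ζ ^ 4) * (1 - ζ ^ 2) * (ζ ^ 5 * (aeval ζ (derivative (cyclotomic 36 ℚ)))⁻¹)) * x i * IsCMField.complexConj K ((1 + 2 * ζ ^ 12) * x j))) :
    a.det = -5184 := by
  rw [realPart_piA_sqrtNegThree hζ hx ha]
  simp [Matrix.det_succ_row_zero, Fin.sum_univ_succ, Fin.succAbove, Matrix.submatrix]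
  norm_num

/-! ### §2 Invariance, census form, class: SPLIT -/

/-- **For EVERY skew `ζ′` of type 𝔮₃ (degree `3`) on `ℤ[ζ_36]` (`IsOfType 1 ζ′ 𝔣₀`, `𝔬𝔣₀ = (π)`, `(𝔬𝔣₀)⁶ = (3)`, degree `3`; `ζ′ = u·πξ`,
`u` a real unit of norm `1` by THEOREM L (i) at `36`) the Gram determinant of `(E_ζ′, s₃)` in the frame `θ^i` is `-5184`**
(they exist on every `ℚ(√−3)`-balanced `Φ`, part 49b): the SPLIT row R0 for `ℚ(√−3)` (census W6.3.1 `= (3, ℚ(√−3), 1)`).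
research route conditional on HC_CM; not a corollary; Q11.4-sentence-2 already refuted in dim ≥ 3. [cite: vanGeemen1994HodgeAV, Lemma 5.2 (3)–(4) and (5.4.1)] [cite: Shimura1998, §14.3 Prop. 4–5, pp. 103–104] -/
theorem det_realPart_typeA_sqrtNegThree [IsCyclotomicExtension {36} ℚ K] [IsCMField K]
    (hζ : IsPrimitiveRoot ζ 36) {𝔣₀ : Ideal (𝓞 (maximalRealSubfield K))}
    (h𝔣₀ : 𝔣₀.map (algebraMap (𝓞 (maximalRealSubfield K)) (𝓞 K)) = Ideal.span {hζ.toInteger ^ 33 * (1 - hζ.toInteger ^ 4) * (1 - hζ.toInteger ^ 2)})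
    {ζ' : K} (hζ' : IsCMField.complexConj K ζ' = -ζ')
    (hT : CMTypeLattice.IsOfType (1 : (FractionalIdeal (𝓞 K)⁰ K)ˣ) ζ' 𝔣₀)
    {x : Fin 6 → K} (hx : ∀ i, x i = (ζ + ζ⁻¹) ^ (i : ℕ)) {a : Matrix (Fin 6) (Fin 6) ℚ}
    (ha : ∀ i j, a i j = Algebra.trace ℚ K (ζ' * x i * IsCMField.complexConj K ((1 + 2 * ζ ^ 12) * x j))) :
    a.det = -5184 := by
  obtain ⟨ωb, hωb⟩ := exists_basis_thetaPow hζ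
  have hx' : ∀ i, x i = (ωb i : K) := fun i => (hx i).trans (hωb i).symm
  have hg : Nat.totient 36 = 2 * (5 + 1) := by decide
  have hsk : IsCMField.complexConj K (ζ ^ 33 * (1 - ζ ^ 4) * (1 - ζ ^ 2) * (ζ ^ 5 * (aeval ζ (derivative (cyclotomic 36 ℚ)))⁻¹)) =
      -(ζ ^ 33 * (1 - ζ ^ 4) * (1 - ζ ^ 2) * (ζ ^ 5 * (aeval ζ (derivative (cyclotomic 36 ℚ)))⁻¹)) := by
    exact complexConj_gen_mul_xi hζ hg adm_thirtySixA
  have h0 : (ζ ^ 33 * (1 - ζ ^ 4) * (1 - ζ ^ 2) * (ζ ^ 5 * (aeval ζ (derivative (cyclotomic 36 ℚ)))⁻¹)) ≠ 0 :=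
    mul_ne_zero (by exact gen_ne_zero hζ adm_thirtySixA) (xi_ne_zero hζ 5)
  have hT₀ : CMTypeLattice.IsOfType (1 : (FractionalIdeal (𝓞 K)⁰ K)ˣ) (ζ ^ 33 * (1 - ζ ^ 4) * (1 - ζ ^ 2) * (ζ ^ 5 * (aeval ζ (derivative (cyclotomic 36 ℚ)))⁻¹)) 𝔣₀ := by
    exact isOfType_one_gen_mul_xi hζ 5 ((4, 2, 33) : ℕ × ℕ × ℕ) h𝔣₀
  rw [det_realPart_eq_of_isOfType ωb (complexConj_sqrtNegThree hζ) hx' (norm_realUnits_pos_thirtySix hζ)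
    hsk h0 hζ' hT₀ hT (fun i j => rfl) ha]
  exact det_realPart_piA_sqrtNegThree hζ hx (fun i j => rfl)

open scoped Classical in
/-- **CENSUS FORM** (part 49b's existence + the determinant): for every CM type `Φ` of `ℚ(ζ_36)` balanced for `N_K = {5, 11, 17, 23, 29, 35}` (Weil signature `(3,3)`
for `K_d = ℚ(√−3)`) and the type `𝔣₀` above, `ℂ^Φ/Φ(ℤ[ζ_36])` carries a `Φ`-positive divisor of type `(K; Φ; 𝔣₀)`, and
EVERY such divisor `X_ζ′` has van Geemen Gram determinant `-5184` in the real frame `θ^i`: the SPLIT row R0 for `ℚ(√−3)` (census W6.3.1 `= (3, ℚ(√−3), 1)`).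
research route conditional on HC_CM; not a corollary; Q11.4-sentence-2 already refuted in dim ≥ 3. [cite: vanGeemen1994HodgeAV, Lemma 5.2 (3)–(4) and (5.4.1)] [cite: Shimura1998, §14.3 Prop. 4–5, pp. 103–104] -/
theorem exists_typeA_sqrtNegThree_det [IsCyclotomicExtension {36} ℚ K] [IsCMField K]
    (hζ : IsPrimitiveRoot ζ 36) (Φ : CMType K)
    (hbal : 2 * (SΦ[Φ, ζ] ∩ ({5, 11, 17, 23, 29, 35} : Finset (ZMod 36))).card = (SΦ[Φ, ζ]).card)
    {𝔣₀ : Ideal (𝓞 (maximalRealSubfield K))}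
    (h𝔣₀ : 𝔣₀.map (algebraMap (𝓞 (maximalRealSubfield K)) (𝓞 K)) =
      Ideal.span {hζ.toInteger ^ 33 * (1 - hζ.toInteger ^ 4) * (1 - hζ.toInteger ^ 2)}) :
    ∃ ζ' : K, IsCMField.complexConj K ζ' = -ζ' ∧ (∀ φ : Φ.1, 0 < (φ.1 ζ').im) ∧
      CMTypeLattice.IsOfType (1 : (FractionalIdeal (𝓞 K)⁰ K)ˣ) ζ' 𝔣₀ ∧
      ∀ (x : Fin 6 → K), (∀ i, x i = (ζ + ζ⁻¹) ^ (i : ℕ)) → ∀ a : Matrix (Fin 6) (Fin 6) ℚ,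
        (∀ i j, a i j = Algebra.trace ℚ K (ζ' * x i * IsCMField.complexConj K ((1 + 2 * ζ ^ 12) * x j))) →
        a.det = -5184 := by
  obtain ⟨ζ', h1, h2, h3⟩ := exists_type_thirtySixA_sqrt_neg_three hζ Φ hbal h𝔣₀
  exact ⟨ζ', h1, h2, h3, fun x hx a ha => det_realPart_typeA_sqrtNegThree hζ h𝔣₀ h1 h3 hx ha⟩

/-- **`[-5184] = [−1]·[5184]` is the SPLIT class `splitDiscriminantClass 3 3` in `ℚˣ/Nm(ℚ(√−3)ˣ)`** (`5184 = 72² + 3·0² ∈ Nm`):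
the type-`𝔮₃` (degree `3`) polarised Weil-type `ℤ[ζ₃₆]`-CM sixfolds lie on the SPLIT row R0 for `ℚ(√−3)` (census W6.3.1 `= (3, ℚ(√−3), 1)`).
research route conditional on HC_CM; not a corollary; Q11.4-sentence-2 already refuted in dim ≥ 3. [cite: vanGeemen1994HodgeAV, 5.4 and (5.4.1)] -/
theorem mk0_det_typeA_sqrtNegThree :
    (QuotientGroup.mk (Units.mk0 (-5184 : ℚ) (by norm_num)) : weilNormResidueGroup 3) = splitDiscriminantClass 3 3 :=
  mk_neg_eq_split_of_odd (by decide) (by norm_num : (5184 : ℚ) ≠ 0)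
    (mem_normUnitsSubgroup_of_sq_add_mul_sq _ (72 : ℚ) (0 : ℚ) (by norm_num))

end Summit.HodgeConjecture.Ring2WeilCoverage.WeilGramLevel36TypeA

end
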